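import Mathlib
import HarnessLib
import Summits.HubbardSuperconductivity.HubbardSuperconductivity.Theorems.KLProgrammeKLRegimeTwoPointLimitCooperResummationFlow

/-!
# Route `KLProgramme`, crux K3 (stmt-HubbardSuperconductivity-19937), child 1 — the Sherman–Morrison DECOMPOSITION of the resummation's
# inverse factor, exported with all its bounds (`klcrf_decomposition`; cell gate-hubbard-kl, seat p1 = C1 lead, g5)

`…CooperResummationFlow` (`klcrf_structure`), `…Offdiag` and `…Weighted` each re-derive, inside their proofs, the same factorisation
`T⁻¹ = (1 − d⁻¹|a⟩⟨w|)·N` of `T = 1 + (uJ + 𝒟)·diag w` (`N = (1 + 𝒟 diag w)⁻¹` by Neumann, `a = u·N1`, `d = 1 + ⟨w, a⟩`).  This module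
EXPORTS it once, with every bound the finer child-1 estimates need (HOME/p1/CHILD1-SKELETON.md §5.1, the «row/column, modulo constants»
Lipschitz lemma `klcrf_lipschitz_rowcol` still to be typed): `(1 + 𝒟 diag w)·N = 1`, `‖N‖ ≤ 3/2`, `|(N − 1)(t,s)| ≤ (3/2)δ·w_s`,
`|(w·N)_s| ≤ (3/2)w_s`, `|a_s − u| ≤ (3/2)u·Wδ` (the rank-one vector is CONSTANT up to `O(Wδ)`), `|a_s| ≤ (3/2)u`, `1 + uW/2 ≤ ‖d‖`, `IsUnit T`.
Pure finite-dimensional linear algebra; nothing about the model is asserted.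
-/

noncomputable section

namespace Summit.HubbardSuperconductivity.HubbardSuperconductivity.Theorems.KLProgrammeCooperResummation

set_option linter.dupNamespace false -- summit = problem name (single-conjunct summit), D-0017

open scoped Matrix.Norms.Operator
open Matrix Finset
open Summit.HubbardSuperconductivity.HubbardSuperconductivity.Theorems.CooperChannelRiccatiFlow

variable {S : Type*} [Fintype S] [DecidableEq S] [Nonempty S]

/-- **Sherman–Morrison decomposition of `(1 + (uJ + 𝒟)·diag w)⁻¹`, with bounds.**  For `w ≥ 0`, `W = Σ w`, `u ≥ 0`, `|𝒟| ≤ δ`, `W·δ ≤ 1/3`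
there are `N`, `a`, `d` with `T⁻¹ = (1 − d⁻¹ • |a⟩⟨w|)·N`, `(1 + 𝒟·diag w)·N = 1`, `‖N‖ ≤ 3/2`, `|(N − 1)(t,s)| ≤ (3/2)δ w_s`,
`|(w N)_s| ≤ (3/2) w_s`, `|a_s − u| ≤ (3/2)u W δ`, `|a_s| ≤ (3/2)u`, `1 + uW/2 ≤ ‖d‖`, and `T` is a unit. -/
theorem klcrf_decomposition (w : S → ℝ) (hw : ∀ s, 0 ≤ w s) {u δ : ℝ} (hu : 0 ≤ u) (hδ : 0 ≤ δ)
    (𝒟 : Matrix S S ℂ) (h𝒟 : ∀ s t, ‖𝒟 s t‖ ≤ δ) (hθ : (∑ s, w s) * δ ≤ 1 / 3) :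
    ∃ (N : Matrix S S ℂ) (a : S → ℂ) (d : ℂ),
      (1 + (Matrix.of (fun _ _ : S => (u : ℂ)) + 𝒟) * Matrix.diagonal (fun s => (w s : ℂ)))⁻¹ =
          (1 - d⁻¹ • Matrix.vecMulVec a (fun s => (w s : ℂ))) * N ∧
      (1 + 𝒟 * Matrix.diagonal (fun s => (w s : ℂ))) * N = 1 ∧ ‖N‖ ≤ 3 / 2 ∧
      (∀ t s, ‖(N - 1) t s‖ ≤ 3 / 2 * δ * w s) ∧ (∀ s, ‖((fun s => (w s : ℂ)) ᵥ* N) s‖ ≤ 3 / 2 * w s) ∧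
      (∀ s, ‖a s - u‖ ≤ 3 / 2 * u * ((∑ s, w s) * δ)) ∧ (∀ s, ‖a s‖ ≤ u * (3 / 2)) ∧
      1 + u * (∑ s, w s) / 2 ≤ ‖d‖ ∧
      IsUnit (1 + (Matrix.of (fun _ _ : S => (u : ℂ)) + 𝒟) * Matrix.diagonal (fun s => (w s : ℂ))) := by
  -- notation
  set W : ℝ := ∑ s, w s with hW_def
  have hW : 0 ≤ W := sum_nonneg fun s _ => hw s
  set wC : S → ℂ := fun s => (w s : ℂ) with hwC_def
  set one : S → ℂ := fun _ => (1 : ℂ) with hone_def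
  set Dw : Matrix S S ℂ := Matrix.diagonal wC with hDw_def
  set J : Matrix S S ℂ := Matrix.of (fun _ _ : S => (u : ℂ)) with hJ_def
  set 𝒞 : Matrix S S ℂ := J + 𝒟 with h𝒞_def
  set X : Matrix S S ℂ := 𝒟 * Dw with hX_def
  have hθ' : W * δ ≤ 1 / 3 := hθ
  have hwsum : ∑ i, ‖wC i‖ = W := by
    rw [hW_def]; exact sum_congr rfl fun i _ => by rw [hwC_def]; simp [abs_of_nonneg (hw i)]
  -- Neumann for `X = 𝒟·diag w` (mass absorbed: `B = 1`)
  have hXn' : ‖X‖ ≤ W * δ := by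
    have := klcr_norm_smul_mul_diagonal_le w hw (zero_le_one) hδ 𝒟 h𝒟
    rw [Complex.ofReal_one, one_smul, one_mul] at this
    exact this
  have hXn : ‖X‖ ≤ 1 / 3 := hXn'.trans hθ'
  obtain ⟨N, hN1, hN2, hNn, hNm1⟩ := klcrf_neumann_sharp X hXn
  have hNm1' : ‖N - 1‖ ≤ 3 / 2 * (W * δ) := hNm1.trans (by nlinarith [norm_nonneg X])
  have hNm1'' : ‖N - 1‖ ≤ 1 / 2 := hNm1.trans (by nlinarith [norm_nonneg X])
  -- `J * Dw = u |𝟙⟩⟨w|` and `T = (1 + X) + u |𝟙⟩⟨w|`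
  have hJDw : J * Dw = (u : ℂ) • Matrix.vecMulVec one wC := by
    ext s t
    simp [hJ_def, hDw_def, Matrix.mul_diagonal, Matrix.vecMulVec_apply, hone_def]
  set T : Matrix S S ℂ := 1 + 𝒞 * Dw with hT_def
  have hT : T = (1 + X) + (u : ℂ) • Matrix.vecMulVec one wC := by
    simp only [hT_def, h𝒞_def, hX_def, add_mul, hJDw]
    abel
  -- Sherman–Morrison data
  set m : S → ℂ := N *ᵥ one with hm_def
  have hm1 : ∀ s, ‖m s - 1‖ ≤ 3 / 2 * (W * δ) := by
    intro s
    have hsplit : m s - 1 = ((N - 1) *ᵥ one) s := by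
      simp only [hm_def, Matrix.sub_mulVec, Matrix.one_mulVec, Pi.sub_apply, hone_def]
    rw [hsplit]
    exact (klcr_mulVec_entry_le (N - 1) one zero_le_one (fun k => by simp [hone_def]) s).trans (by linarith)
  have hm1' : ∀ s, ‖m s - 1‖ ≤ 1 / 2 := fun s => (hm1 s).trans (by nlinarith)
  have hm_bound : ∀ s, ‖m s‖ ≤ 3 / 2 := by
    intro s
    calc ‖m s‖ = ‖(m s - 1) + 1‖ := by rw [sub_add_cancel]
      _ ≤ ‖m s - 1‖ + ‖(1 : ℂ)‖ := norm_add_le _ _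
      _ ≤ 3 / 2 := by rw [norm_one]; linarith [hm1' s]
  have hm_re : ∀ s, 1 / 2 ≤ (m s).re := by
    intro s
    have h := (Complex.abs_re_le_norm (m s - 1)).trans (hm1' s)
    rw [Complex.sub_re, Complex.one_re, abs_le] at h
    linarith [h.1]
  set a : S → ℂ := (u : ℂ) • m with ha_def
  have ha_bound : ∀ s, ‖a s‖ ≤ u * (3 / 2) := by
    intro s
    simp only [ha_def, Pi.smul_apply, smul_eq_mul, norm_mul, Complex.norm_real, Real.norm_eq_abs, abs_of_nonneg hu]
    exact mul_le_mul_of_nonneg_left (hm_bound s) hu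
  set d : ℂ := 1 + wC ⬝ᵥ a with hd_def
  -- `d = 1 + uW + u⟨w, m - 1⟩`
  have hd_split : d = 1 + (u : ℂ) * W + (u : ℂ) * ∑ s, wC s * (m s - 1) := by
    simp only [hd_def, dotProduct, ha_def, Pi.smul_apply, smul_eq_mul, hW_def, Complex.ofReal_sum, hwC_def]
    rw [Finset.mul_sum, Finset.mul_sum, add_assoc, ← Finset.sum_add_distrib]
    congr 1
    exact sum_congr rfl fun s _ => by ring
  have hwm : ‖∑ s, wC s * (m s - 1)‖ ≤ W * (3 / 2 * (W * δ)) := by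
    calc ‖∑ s, wC s * (m s - 1)‖ ≤ ∑ s, ‖wC s * (m s - 1)‖ := norm_sum_le _ _
      _ ≤ ∑ s, w s * (3 / 2 * (W * δ)) := sum_le_sum fun s _ => by
          rw [norm_mul, hwC_def]
          simp only [Complex.norm_real, Real.norm_eq_abs, abs_of_nonneg (hw s)]
          exact mul_le_mul_of_nonneg_left (hm1 s) (hw s)
      _ = W * (3 / 2 * (W * δ)) := by rw [← Finset.sum_mul]
  have hd_re : 1 + u * W / 2 ≤ d.re := by
    have hsum : (wC ⬝ᵥ a).re = ∑ s, u * (w s * (m s).re) := by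
      simp only [dotProduct, Complex.re_sum, hwC_def, ha_def, Pi.smul_apply, smul_eq_mul]
      refine sum_congr rfl fun s _ => ?_
      have : ((w s : ℂ) * ((u : ℂ) * m s)).re = u * (w s * (m s).re) := by
        simp [Complex.mul_re, Complex.ofReal_re, Complex.ofReal_im]; ring
      exact this
    rw [hd_def, Complex.add_re, Complex.one_re, hsum, ← Finset.mul_sum]
    have : W / 2 ≤ ∑ s, w s * (m s).re := by
      rw [hW_def, Finset.sum_div]
      exact sum_le_sum fun s _ => by have := mul_le_mul_of_nonneg_left (hm_re s) (hw s); linarith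
    nlinarith
  have hd_norm : 1 + u * W / 2 ≤ ‖d‖ := hd_re.trans (Complex.re_le_norm d)
  have hd_pos : 0 < ‖d‖ := lt_of_lt_of_le (by nlinarith [mul_nonneg hu hW]) hd_norm
  have hd_ne : d ≠ 0 := norm_pos_iff.mp hd_pos
  -- the right inverse `R = (1 - d⁻¹ |a⟩⟨w|) N`
  set V : Matrix S S ℂ := Matrix.vecMulVec a wC with hV_def
  set R : Matrix S S ℂ := (1 - d⁻¹ • V) * N with hR_def
  have hNa : (1 + X) *ᵥ a = (u : ℂ) • one := by
    simp only [ha_def, Matrix.mulVec_smul, hm_def, Matrix.mulVec_mulVec, hN1, Matrix.one_mulVec]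
  have hfac : T = (1 + X) * (1 + V) := by
    rw [mul_add, mul_one, hV_def, Matrix.mul_vecMulVec, hNa, hT]
    congr 1
    ext s t
    simp [Matrix.vecMulVec_apply, hone_def]
  have hVV : V * V = (wC ⬝ᵥ a) • V := by
    rw [hV_def, Matrix.vecMulVec_mul_vecMulVec, Matrix.vecMulVec_smul]
  have hSM : (1 + V) * (1 - d⁻¹ • V) = 1 := by
    calc (1 + V) * (1 - d⁻¹ • V) = (1 + V) - d⁻¹ • ((1 + V) * V) := by rw [mul_sub, mul_one, mul_smul_comm]
      _ = (1 + V) - d⁻¹ • ((1 + wC ⬝ᵥ a) • V) := by rw [add_mul, one_mul, hVV, add_smul, one_smul]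
      _ = (1 + V) - (d⁻¹ * d) • V := by rw [smul_smul, hd_def]
      _ = 1 := by rw [inv_mul_cancel₀ hd_ne, one_smul, add_sub_cancel_right]
  have hTR : T * R = 1 := by
    rw [hfac, hR_def, ← mul_assoc, mul_assoc (1 + X), hSM, mul_one, hN1]
  have hTunit : IsUnit T := by
    rw [Matrix.isUnit_iff_isUnit_det]
    exact Matrix.isUnit_det_of_right_inverse hTR
  have hTinv : T⁻¹ = R := Matrix.inv_eq_right_inv hTR
  -- weighted column sums of `N`
  have hid : N - 1 = -(X * N) := by
    have h1' : N + X * N = 1 := by rw [add_mul, one_mul] at hN1; exact hN1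
    calc N - 1 = N - (N + X * N) := by rw [h1']
      _ = -(X * N) := by abel
  have hXentry : ∀ t r, ‖X t r‖ ≤ δ * w r := by
    intro t r
    simp only [hX_def, hDw_def, Matrix.mul_diagonal, hwC_def, norm_mul, Complex.norm_real, Real.norm_eq_abs, abs_of_nonneg (hw r)]
    exact mul_le_mul_of_nonneg_right (h𝒟 t r) (hw r)
  set col : S → ℝ := fun s => ∑ t, w t * ‖N t s‖ with hcol_def
  have hcol_nonneg : ∀ s, 0 ≤ col s := fun s => sum_nonneg fun t _ => mul_nonneg (hw t) (norm_nonneg _)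
  -- `|(N - 1) t s| ≤ δ · col s`
  have hNm1_entry : ∀ t s, ‖(N - 1) t s‖ ≤ δ * col s := by
    intro t s
    rw [hid, Matrix.neg_apply, norm_neg, Matrix.mul_apply]
    calc ‖∑ r, X t r * N r s‖ ≤ ∑ r, ‖X t r * N r s‖ := norm_sum_le _ _
      _ ≤ ∑ r, δ * w r * ‖N r s‖ := sum_le_sum fun r _ => by
          rw [norm_mul]; exact mul_le_mul_of_nonneg_right (hXentry t r) (norm_nonneg _)
      _ = δ * col s := by rw [hcol_def]; simp only [mul_assoc, ← Finset.mul_sum]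
  -- `col s ≤ w s + W δ col s`, hence `col s ≤ (3/2) w s`
  have hcol_le : ∀ s, col s ≤ 3 / 2 * w s := by
    intro s
    have h1 : col s ≤ w s + W * δ * col s := by
      calc col s = ∑ t, w t * ‖N t s‖ := rfl
        _ ≤ ∑ t, w t * (‖(1 : Matrix S S ℂ) t s‖ + ‖(N - 1) t s‖) := sum_le_sum fun t _ => by
            refine mul_le_mul_of_nonneg_left ?_ (hw t)
            have : N t s = (1 : Matrix S S ℂ) t s + (N - 1) t s := by simp
            rw [this]; exact norm_add_le _ _
        _ = ∑ t, w t * ‖(1 : Matrix S S ℂ) t s‖ + ∑ t, w t * ‖(N - 1) t s‖ := by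
            rw [← sum_add_distrib]; exact sum_congr rfl fun t _ => by ring
        _ ≤ w s + ∑ t, w t * (δ * col s) := by
            refine add_le_add ?_ (sum_le_sum fun t _ => mul_le_mul_of_nonneg_left (hNm1_entry t s) (hw t))
            rw [Finset.sum_eq_single s]
            · simp
            · intro t _ hts; simp [Matrix.one_apply_ne hts]
            · simp
        _ = w s + W * δ * col s := by rw [← Finset.sum_mul, hW_def]; ring
    have h2 : (1 - W * δ) * col s ≤ w s := by nlinarith
    have h3 : 2 / 3 ≤ 1 - W * δ := by linarith
    nlinarith [hcol_nonneg s]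
  -- entries of `N - 1` and the weighted row `w N`
  have hNm1_le : ∀ t s, ‖(N - 1) t s‖ ≤ 3 / 2 * δ * w s := fun t s =>
    (hNm1_entry t s).trans (by nlinarith [hcol_le s, hδ])
  have hwN_le : ∀ s, ‖(wC ᵥ* N) s‖ ≤ 3 / 2 * w s := by
    intro s
    rw [Matrix.vecMul, dotProduct]
    calc ‖∑ t, wC t * N t s‖ ≤ ∑ t, ‖wC t * N t s‖ := norm_sum_le _ _
      _ = col s := by
          rw [hcol_def]; refine sum_congr rfl fun t _ => ?_
          rw [norm_mul, hwC_def]; simp [abs_of_nonneg (hw t)]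
      _ ≤ 3 / 2 * w s := hcol_le s
  -- the rank-one vector is constant up to `O(Wδ)`
  have ha_sub : ∀ s, ‖a s - u‖ ≤ 3 / 2 * u * (W * δ) := by
    intro s
    have h1 : a s - u = (u : ℂ) * (m s - 1) := by
      simp only [ha_def, Pi.smul_apply, smul_eq_mul]; ring
    rw [h1, norm_mul, Complex.norm_real, Real.norm_eq_abs, abs_of_nonneg hu]
    nlinarith [hm1 s, norm_nonneg (m s - 1)]
  exact ⟨N, a, d, hTinv, hN1, hNn, hNm1_le, hwN_le, ha_sub, ha_bound, hd_norm, hTunit⟩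

end Summit.HubbardSuperconductivity.HubbardSuperconductivity.Theorems.KLProgrammeCooperResummation

end
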